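import Summits.ABC.IUTFork.Cor312GenuineKWildExactDecided
import Summits.ABC.IUTFork.Conditional.AbcOfSGenuineKChosenDepthRadRows3
import Summits.ABC.IUTFork.Conditional.AbcOfSGenuineKTameRobustRows5
import Summits.ABC.IUTFork.Conditional.AbcOfSGenuineKLinUniformRows3
import HarnessLib

/-!
# [IUTchIII] Cor. 3.12, branch C / R-W window table — the EXACT wild local type at `p ∈ {3, 5}` READ OFF AN abc TRIPLE:
# `hpole` from `p^v ∥ abc`, and the W2 / SPLIT test as ONE integer divisibility
# `p² ∣ D`, `D = ((abc/p^v)²)^{p−1} − (2⁸(cb + a²)³)^{p−1}` (one `decide`/`norm_num` per datum)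

PROOF-ONLY support file (D-0012; 0 definitions, 0 `Prop` facts) of the abc-iut cell (R-W «WINDOW Θ-SIDE INEQUALITY», seat
abc-iut-W-neg-1 gen 3; GAP G-Wnum2-1 (i), instantiation layer). TAKES NO SIDE on [IUTchIII] Cor. 3.12 (S. Mochizuki, *Inter-universal
Teichmüller theory III*, Cor. 3.12 p. 173–174) or on any author.

For an abc triple `a + b = c` the Legendre/Frey point is `λ = a/c` with `j(λ) = 2⁸(cb + a²)³/(abc)²` (`Cor22.jInv_ratPoint_triple`), so at
an odd prime `p` with `p^v ∥ abc` the pole order is `2t = 2v` (`RadTriple.ord_jInv_eq_of_pow_dvd`, abc-iut-w5-d236) and the unit part of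
`j⁻¹p^{−2v}` is `u = M²/N₀`, `M = abc/p^v`, `N₀ = 2⁸(cb + a²)³` (both prime to `p`). Hence `u^{p−1} − 1 = D/N₀^{p−1}` with the INTEGER
`D = (M²)^{p−1} − N₀^{p−1}`, and the three kernel local types of this seat's lineage become instantiable from `(a, b, c, p, v)` and ONE
divisibility of integer literals:

* `RadTriple.ord_jInv_eq_neg_two_mul` — `hpole` in the `−(2·v)` shape of the `GenuineK.…_ratPoint` theorems;
* `RadTriple.jInv_inv_div_pow_eq` — `j(λ)⁻¹/p^{2v} = (M² : ℚ)/N₀`; `RadTriple.not_dvd_N₀` — `p ∤ N₀`;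
* `RadTriple.split_test_of_sq_dvd` — `p² ∣ D ⇒ u^{p−1} = 1 ∨ v_p(u^{p−1} − 1) ≥ 2` (SPLIT);
  `RadTriple.unit_test_of_dvd_of_not_sq_dvd` — `p ∣ D`, `p² ∤ D ⇒ v_p(u^{p−1} − 1) = 1` (W2);
* **`GenuineK.absRamificationIdx_kOf_eq_wild_of_triple`** (W1: `p ∤ v` ⇒ `e = p(p−1)·(p′/gcd(p′,v))·l`, gen 2's theorem),
  **`GenuineK.absRamificationIdx_kOf_eq_wildUnit_of_triple`** (W2: `p ∣ v`, `p ∣ D`, `p² ∤ D` ⇒ the same `e`),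
  **`GenuineK.absRamificationIdx_kOf_eq_wildSplit_of_triple`** (SPLIT: `p ∣ v`, `p² ∣ D` ⇒ `e = (p−1)·(p′/gcd(p′,v))·l`).

Example (R-W «FREY-PINNED-28», set (A)): `7³29⁵151² + 2⁴5¹⁶97·919 = 3²⁷13⁴` at `p = 3`: `v = 27`, `3 ∣ v`, `9 ∣ D` ⇒ SPLIT,
`e(K_{x₀}/ℚ₃) = 2·(5/gcd(5,27))·l = 10·l`; `2¹²13³223³ + 3¹⁵11³97⁵409 = 5¹⁵179⁴2141` at `3`: `v = 15`, SPLIT, `e = 2·l`.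

HONEST FRAMING: bookkeeping over OUR typed objects; nothing here bears on the printed inequality of [IUTchIII] Cor. 3.12 or on the
number-level `Cor22.Cor312AtDatum`; typed ≠ proved; instantiated ≠ endorsed. [cite: Serre1972, §1.11–§1.12] [cite: Serre1973, Ch. II §3.3]
[cite: Mochizuki2012, IUTchIV Thm. 1.10 p. 22; Cor. 2.2 (ii) proof p. 44] [cite: SilvermanAEC2009, Prop. III.1.7 (b)]
[claim: Mochizuki2012, status: disputed] for every IUT quotation.
-/

noncomputable section

open NumberField IsDedekindDomain

namespace Summit.ABC.IUTFork.Conditional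

open Thm311 Thm311.Real Cor312 Cor312Prov Literature.IUT.LogVolume Literature.IUT.HodgeTheaters
  Literature.IUT.LogThetaLattice Literature.NumberTheory.NumberFields Literature.NumberTheory.DiophantineGeometry.GenEll
  Literature.NumberTheory.DiophantineGeometry Literature.NumberTheory.EllipticCurves Summit.ABC.ABC.Theorems

/-! ## 0. The rational data of an abc-triple datum at an odd prime `p^v ∥ abc` -/

section Dictionary

variable {a b c : ℕ} (habc : IsABCTriple a b c) {p : ℕ} (hp : p.Prime) (hp2 : p ≠ 2) {v : ℕ} (hv : 1 ≤ v)
  (hdvd : p ^ v ∣ a * b * c) (hndvd : ¬ p ^ (v + 1) ∣ a * b * c)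

include habc hp hp2 hv hdvd hndvd in
/-- `hpole` read off the triple: `ord_u j(a/c) = −(2·v)` at every place `u ∣ p` (the shape consumed by the `GenuineK.…_ratPoint`
local-type theorems; `RadTriple.ord_jInv_eq_of_pow_dvd`). [cite: Mochizuki2012, IUTchIV Cor. 2.2 (ii) proof p. 44] -/
theorem RadTriple.ord_jInv_eq_neg_two_mul :
    ∀ u : HeightOneSpectrum (𝓞 ℚ), Rat.HeightOneSpectrum.natGenerator u = p →
      Literature.IUT.LogVolume.ord ℚ u (Cor22.jInv ((a : ℚ) / c)) = -(2 * (v : ℤ)) := fun u hu => by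
  rw [RadTriple.ord_jInv_eq_of_pow_dvd habc hp hp2 hv hdvd hndvd u hu]; push_cast; ring

include habc in
/-- `abc ≠ 0` and `N₀ = 2⁸(cb + a²)³ ≠ 0` for an abc triple. [folklore] -/
private theorem RadTriple.ne_zero_aux : a * b * c ≠ 0 ∧ 256 * (c * b + a * a) ^ 3 ≠ 0 := by
  obtain ⟨ha, hb, hsum, -⟩ := habc
  refine ⟨Nat.mul_ne_zero (Nat.mul_ne_zero ha.ne' hb.ne') (by omega), Nat.mul_ne_zero (by norm_num) (pow_ne_zero _ ?_)⟩
  have : 0 < a * a := Nat.mul_pos ha ha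
  omega

include habc hp hdvd in
/-- **The unit part of `j⁻¹` at `p`: `j(a/c)⁻¹/p^{2v} = (abc/p^v)²/(2⁸(cb + a²)³)`** (`Cor22.jInv_ratPoint_triple`:
`j(a/c) = 2⁸(cb + a²)³/(abc)²`). [cite: SilvermanAEC2009, Prop. III.1.7 (b)] [cite: Mochizuki2012, IUTchIV Cor. 2.2 (ii) proof p. 44] -/
theorem RadTriple.jInv_inv_div_pow_eq :
    (Cor22.jInv ((a : ℚ) / c))⁻¹ / (p : ℚ) ^ (2 * v) =
      (((a * b * c / p ^ v : ℕ) : ℚ) ^ 2) / ((256 * (c * b + a * a) ^ 3 : ℕ) : ℚ) := by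
  obtain ⟨habc0, hN0⟩ := RadTriple.ne_zero_aux habc
  have hpQ : (p : ℚ) ≠ 0 := Nat.cast_ne_zero.mpr hp.ne_zero
  have hM : a * b * c = p ^ v * (a * b * c / p ^ v) := (Nat.mul_div_cancel' hdvd).symm
  have hMQ : ((a * b * c : ℕ) : ℚ) = (p : ℚ) ^ v * ((a * b * c / p ^ v : ℕ) : ℚ) := by exact_mod_cast hM
  have hN0Q : ((256 * (c * b + a * a) ^ 3 : ℕ) : ℚ) ≠ 0 := by exact_mod_cast hN0
  have habcQ : ((a * b * c : ℕ) : ℚ) ≠ 0 := by exact_mod_cast habc0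
  rw [Cor22.jInv_ratPoint_triple habc]
  have hsq : (((a * b * c) ^ 2 : ℕ) : ℚ) = ((a * b * c : ℕ) : ℚ) ^ 2 := by push_cast; ring
  rw [hsq, hMQ]
  field_simp
  ring

include habc hp hp2 hv hdvd in
/-- `p ∤ N₀ = 2⁸(cb + a²)³`: if the odd prime `p` divides one of the pairwise coprime `a, b, c` it does not divide `cb + a²`
(the argument of `Cor22.ord_jInv_ratPoint_triple_eq`). [cite: Mochizuki2012, IUTchIV Cor. 2.2 (ii) proof p. 44] -/
theorem RadTriple.not_dvd_N₀ : ¬ p ∣ 256 * (c * b + a * a) ^ 3 := by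
  obtain ⟨ha, hb, hsum, hcop⟩ := habc
  have hpabc : p ∣ a * b * c := (dvd_pow_self p (by omega)).trans hdvd
  have hcopac : Nat.Coprime a c := by rw [← hsum, Nat.coprime_self_add_right]; exact hcop
  intro hdvd'
  have h256 : ¬ p ∣ 256 := by
    intro h'
    have : p ∣ 2 ^ 8 := by norm_num at h' ⊢; exact h'
    exact hp2 ((Nat.prime_dvd_prime_iff_eq hp Nat.prime_two).1 (hp.dvd_of_dvd_pow this))
  have hK : p ∣ c * b + a * a := by
    rcases (Nat.Prime.dvd_mul hp).1 hdvd' with h' | h'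
    · exact absurd h' h256
    · exact hp.dvd_of_dvd_pow h'
  rcases (Nat.Prime.dvd_mul hp).1 hpabc with hab | hpc
  · rcases (Nat.Prime.dvd_mul hp).1 hab with hpa | hpb
    · have h1 : p ∣ c * b := by
        have : p ∣ a * a := dvd_mul_of_dvd_left hpa a
        exact (Nat.dvd_add_left this).mp hK
      rcases (Nat.Prime.dvd_mul hp).1 h1 with hpc | hpb
      · exact hp.one_lt.ne' (Nat.eq_one_of_dvd_coprimes hcopac hpa hpc)
      · exact hp.one_lt.ne' (Nat.eq_one_of_dvd_coprimes hcop hpa hpb)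
    · have h1 : p ∣ a * a := by
        have : p ∣ c * b := dvd_mul_of_dvd_right hpb c
        exact (Nat.dvd_add_right this).mp hK
      have hpa := hp.dvd_of_dvd_pow (by simpa [sq] using h1 : p ∣ a ^ 2)
      exact hp.one_lt.ne' (Nat.eq_one_of_dvd_coprimes hcop hpa hpb)
  · have h1 : p ∣ a * a := by
      have : p ∣ c * b := dvd_mul_of_dvd_left hpc b
      exact (Nat.dvd_add_right this).mp hK
    have hpa := hp.dvd_of_dvd_pow (by simpa [sq] using h1 : p ∣ a ^ 2)
    exact hp.one_lt.ne' (Nat.eq_one_of_dvd_coprimes hcopac hpa hpc)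

/-- `((M²/N)^k − 1) = ((M²)^k − N^k)/N^k` over `ℚ`, integers inside. [folklore] -/
private theorem RadTriple.pow_sub_one_eq (M N k : ℕ) (hN : (N : ℚ) ≠ 0) :
    (((M : ℚ) ^ 2) / (N : ℚ)) ^ k - 1 = (((((M : ℤ) ^ 2) ^ k - (N : ℤ) ^ k : ℤ)) : ℚ) / (N : ℚ) ^ k := by
  have hNk : (N : ℚ) ^ k ≠ 0 := pow_ne_zero _ hN
  push_cast
  rw [div_pow, eq_div_iff hNk, sub_mul, div_mul_cancel₀ _ hNk, one_mul]

/-- `v_p((M²/N)^k − 1) = v_p((M²)^k − N^k)` when `p ∤ N` and the integer is non-zero. [folklore] -/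
private theorem RadTriple.padicValRat_pow_sub_one {p : ℕ} [Fact p.Prime] (M N k : ℕ) (hNp : ¬ p ∣ N)
    (hD0 : ((((M : ℤ) ^ 2) ^ k - (N : ℤ) ^ k : ℤ)) ≠ 0) :
    padicValRat p ((((M : ℚ) ^ 2) / (N : ℚ)) ^ k - 1) = padicValInt p (((M : ℤ) ^ 2) ^ k - (N : ℤ) ^ k) := by
  have hN0 : N ≠ 0 := fun h0 => hNp (h0 ▸ dvd_zero p)
  have hNQ : (N : ℚ) ≠ 0 := Nat.cast_ne_zero.mpr hN0
  rw [RadTriple.pow_sub_one_eq M N k hNQ, padicValRat.div (by exact_mod_cast hD0) (pow_ne_zero _ hNQ), padicValRat.of_int,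
    padicValRat.pow, padicValRat.of_nat, padicValNat.eq_zero_of_not_dvd hNp]
  push_cast; ring

include habc hp hp2 hv hdvd in
/-- **SPLIT test as ONE integer divisibility: `p² ∣ D ⇒ u^{p−1} = 1 ∨ v_p(u^{p−1} − 1) ≥ 2`**, `u = j(a/c)⁻¹/p^{2v}`,
`D = ((abc/p^v)²)^{p−1} − (2⁸(cb + a²)³)^{p−1}`. [cite: Serre1973, Ch. II §3.3] -/
theorem RadTriple.split_test_of_sq_dvd
    (hD : ((p : ℤ) ^ 2) ∣ (((a * b * c / p ^ v : ℕ) : ℤ) ^ 2) ^ (p - 1) - ((256 * (c * b + a * a) ^ 3 : ℕ) : ℤ) ^ (p - 1)) :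
    ((Cor22.jInv ((a : ℚ) / c))⁻¹ / (p : ℚ) ^ (2 * v)) ^ (p - 1) = 1 ∨
      2 ≤ padicValRat p ((((Cor22.jInv ((a : ℚ) / c))⁻¹ / (p : ℚ) ^ (2 * v)) ^ (p - 1) - 1)) := by
  haveI : Fact p.Prime := ⟨hp⟩
  obtain ⟨-, hN0⟩ := RadTriple.ne_zero_aux habc
  have hN0Q : ((256 * (c * b + a * a) ^ 3 : ℕ) : ℚ) ≠ 0 := by exact_mod_cast hN0
  have hNp := RadTriple.not_dvd_N₀ habc hp hp2 hv hdvd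
  rw [RadTriple.jInv_inv_div_pow_eq habc hp hdvd]
  by_cases hD0 : ((((a * b * c / p ^ v : ℕ) : ℤ) ^ 2) ^ (p - 1) - ((256 * (c * b + a * a) ^ 3 : ℕ) : ℤ) ^ (p - 1) : ℤ) = 0
  · left
    have h := RadTriple.pow_sub_one_eq (a * b * c / p ^ v) (256 * (c * b + a * a) ^ 3) (p - 1) hN0Q
    rw [hD0, Int.cast_zero, zero_div, sub_eq_zero] at h
    exact h
  · right
    rw [RadTriple.padicValRat_pow_sub_one (a * b * c / p ^ v) (256 * (c * b + a * a) ^ 3) (p - 1) hNp hD0]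
    rcases (padicValInt_dvd_iff 2 _).mp hD with h | h
    · exact absurd h hD0
    · exact_mod_cast h

include habc hp hp2 hv hdvd in
/-- **W2 test as integer divisibilities: `p ∣ D`, `p² ∤ D ⇒ v_p(u^{p−1} − 1) = 1`.** [cite: Serre1973, Ch. II §3.3] -/
theorem RadTriple.unit_test_of_dvd_of_not_sq_dvd
    (hD1 : (p : ℤ) ∣ (((a * b * c / p ^ v : ℕ) : ℤ) ^ 2) ^ (p - 1) - ((256 * (c * b + a * a) ^ 3 : ℕ) : ℤ) ^ (p - 1))
    (hD2 : ¬ ((p : ℤ) ^ 2) ∣ (((a * b * c / p ^ v : ℕ) : ℤ) ^ 2) ^ (p - 1) - ((256 * (c * b + a * a) ^ 3 : ℕ) : ℤ) ^ (p - 1)) :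
    padicValRat p ((((Cor22.jInv ((a : ℚ) / c))⁻¹ / (p : ℚ) ^ (2 * v)) ^ (p - 1) - 1)) = 1 := by
  haveI : Fact p.Prime := ⟨hp⟩
  have hNp := RadTriple.not_dvd_N₀ habc hp hp2 hv hdvd
  have hD0 : ((((a * b * c / p ^ v : ℕ) : ℤ) ^ 2) ^ (p - 1) - ((256 * (c * b + a * a) ^ 3 : ℕ) : ℤ) ^ (p - 1) : ℤ) ≠ 0 :=
    fun h0 => hD2 (h0 ▸ dvd_zero _)
  rw [RadTriple.jInv_inv_div_pow_eq habc hp hdvd,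
    RadTriple.padicValRat_pow_sub_one (a * b * c / p ^ v) (256 * (c * b + a * a) ^ 3) (p - 1) hNp hD0]
  have h1 : 1 ≤ padicValInt p ((((a * b * c / p ^ v : ℕ) : ℤ) ^ 2) ^ (p - 1) - ((256 * (c * b + a * a) ^ 3 : ℕ) : ℤ) ^ (p - 1)) := by
    have hD1' : (p : ℤ) ^ 1 ∣ (((a * b * c / p ^ v : ℕ) : ℤ) ^ 2) ^ (p - 1) - ((256 * (c * b + a * a) ^ 3 : ℕ) : ℤ) ^ (p - 1) := by
      rwa [pow_one]
    rcases (padicValInt_dvd_iff 1 _).mp hD1' with h | h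
    · exact absurd h hD0
    · exact_mod_cast h
  have h2 : ¬ 2 ≤ padicValInt p ((((a * b * c / p ^ v : ℕ) : ℤ) ^ 2) ^ (p - 1) - ((256 * (c * b + a * a) ^ 3 : ℕ) : ℤ) ^ (p - 1)) :=
    fun h => hD2 ((padicValInt_dvd_iff 2 _).mpr (Or.inr h))
  have h3 : (padicValInt p ((((a * b * c / p ^ v : ℕ) : ℤ) ^ 2) ^ (p - 1) - ((256 * (c * b + a * a) ^ 3 : ℕ) : ℤ) ^ (p - 1)) : ℤ)
      = 1 := by omega
  exact_mod_cast h3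

end Dictionary

/-! ## 1. The three exact wild local types, read off the triple -/

section LocalType

variable {a b c : ℕ} (habc : IsABCTriple a b c) {l : ℕ} (T : Cor22.ThetaVolumeDatumAt (ratPoint ((a : ℚ) / c)) l)
  (pp : Nat.Primes) {p' : ℕ} (hpq : ((pp : ℕ) = 3 ∧ p' = 5) ∨ ((pp : ℕ) = 5 ∧ p' = 3)) (hpl : (pp : ℕ) ≠ l)
  {v : ℕ} (hv : 1 ≤ v) (hdvd : (pp : ℕ) ^ v ∣ a * b * c) (hndvd : ¬ (pp : ℕ) ^ (v + 1) ∣ a * b * c)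

include habc hpq hpl hv hdvd hndvd in
/-- **W1 at an abc triple: `p ∤ v ⇒ e(K_{x₀}/ℚ_p) = p(p−1)·(p′/gcd(p′, v))·l`** at every fibre point `x₀ ∣ p ∈ {3, 5}` (`p ≠ l`) of the pilot
datum of a genuine Θ-volume datum at `(ratPoint (a/c), l)`, `p^v ∥ abc` (gen 2's `GenuineK.absRamificationIdx_kOf_eq_wild_ratPoint` +
`RadTriple.ord_jInv_eq_of_pow_dvd`). [cite: Serre1972, §1.11–§1.12] [cite: Mochizuki2012, IUTchIV Thm. 1.10 p. 22] [claim: Mochizuki2012, status: disputed] -/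
theorem GenuineK.absRamificationIdx_kOf_eq_wild_of_triple (hpt : ¬ (pp : ℕ) ∣ v) :
    letI := T.instFieldF; letI := T.instNumberFieldF; letI := T.instAlgebraF; letI := T.instFieldK
    letI := T.instNumberFieldK; letI := T.instAlgebraK; letI := T.instFieldFbar; letI := T.instAlgebraFbar
    letI := T.instAlgebraKFbar; letI := T.instIsElliptic
    haveI : Fact (pp : ℕ).Prime := ⟨pp.2⟩
    ∀ x₀ : (thetaIndex (pilotDataOfK T.D T.K)).Fibre (.inr pp),
      absRamificationIdx (pp : ℕ) (kOf (pilotDataOfK T.D T.K) pp.1 x₀) = pp * (pp - 1) * (p' / Nat.gcd p' v) * l := by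
  have hp2 : (pp : ℕ) ≠ 2 := by rcases hpq with ⟨h, -⟩ | ⟨h, -⟩ <;> omega
  exact GenuineK.absRamificationIdx_kOf_eq_wild_ratPoint T pp hpq hpl hv hpt
    (RadTriple.ord_jInv_eq_neg_two_mul habc pp.2 hp2 hv hdvd hndvd)

include habc hpq hpl hv hdvd hndvd in
/-- **W2 at an abc triple: `p ∣ v`, `p ∣ D`, `p² ∤ D ⇒ e(K_{x₀}/ℚ_p) = p(p−1)·(p′/gcd(p′, v))·l`**, `D = ((abc/p^v)²)^{p−1} − (2⁸(cb+a²)³)^{p−1}`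
(gen 2's `GenuineK.absRamificationIdx_kOf_eq_wildUnit_ratPoint` + `RadTriple.unit_test_of_dvd_of_not_sq_dvd`).
[cite: Serre1972, §1.11–§1.12] [cite: Serre1973, Ch. II §3.3] [cite: Mochizuki2012, IUTchIV Thm. 1.10 p. 22] [claim: Mochizuki2012, status: disputed] -/
theorem GenuineK.absRamificationIdx_kOf_eq_wildUnit_of_triple (hpt : (pp : ℕ) ∣ v)
    (hD1 : ((pp : ℕ) : ℤ) ∣ (((a * b * c / (pp : ℕ) ^ v : ℕ) : ℤ) ^ 2) ^ ((pp : ℕ) - 1) - ((256 * (c * b + a * a) ^ 3 : ℕ) : ℤ) ^ ((pp : ℕ) - 1))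
    (hD2 : ¬ (((pp : ℕ) : ℤ) ^ 2) ∣
      (((a * b * c / (pp : ℕ) ^ v : ℕ) : ℤ) ^ 2) ^ ((pp : ℕ) - 1) - ((256 * (c * b + a * a) ^ 3 : ℕ) : ℤ) ^ ((pp : ℕ) - 1)) :
    letI := T.instFieldF; letI := T.instNumberFieldF; letI := T.instAlgebraF; letI := T.instFieldK
    letI := T.instNumberFieldK; letI := T.instAlgebraK; letI := T.instFieldFbar; letI := T.instAlgebraFbar
    letI := T.instAlgebraKFbar; letI := T.instIsElliptic
    haveI : Fact (pp : ℕ).Prime := ⟨pp.2⟩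
    ∀ x₀ : (thetaIndex (pilotDataOfK T.D T.K)).Fibre (.inr pp),
      absRamificationIdx (pp : ℕ) (kOf (pilotDataOfK T.D T.K) pp.1 x₀) = pp * (pp - 1) * (p' / Nat.gcd p' v) * l := by
  have hp2 : (pp : ℕ) ≠ 2 := by rcases hpq with ⟨h, -⟩ | ⟨h, -⟩ <;> omega
  exact GenuineK.absRamificationIdx_kOf_eq_wildUnit_ratPoint T pp hpq hpl hv hpt
    (RadTriple.ord_jInv_eq_neg_two_mul habc pp.2 hp2 hv hdvd hndvd)
    (RadTriple.unit_test_of_dvd_of_not_sq_dvd habc pp.2 hp2 hv hdvd hD1 hD2)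

include habc hpq hpl hv hdvd hndvd in
/-- **SPLIT at an abc triple: `p ∣ v`, `p² ∣ D ⇒ e(K_{x₀}/ℚ_p) = (p−1)·(p′/gcd(p′, v))·l` — NO wild factor**,
`D = ((abc/p^v)²)^{p−1} − (2⁸(cb+a²)³)^{p−1}` (gen 3's `GenuineK.absRamificationIdx_kOf_eq_wildSplit_ratPoint` + `RadTriple.split_test_of_sq_dvd`).
E.g. `7³29⁵151² + 2⁴5¹⁶97·919 = 3²⁷13⁴` at `3` (`v = 27`): `e = 10·l`; `2¹²13³223³ + 3¹⁵11³97⁵409 = 5¹⁵179⁴2141` at `3` (`v = 15`): `e = 2·l`.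
[cite: Serre1972, §1.11–§1.12] [cite: Serre1973, Ch. II §3.3] [cite: Mochizuki2012, IUTchIV Thm. 1.10 p. 22] [claim: Mochizuki2012, status: disputed] -/
theorem GenuineK.absRamificationIdx_kOf_eq_wildSplit_of_triple (hpt : (pp : ℕ) ∣ v)
    (hD : (((pp : ℕ) : ℤ) ^ 2) ∣
      (((a * b * c / (pp : ℕ) ^ v : ℕ) : ℤ) ^ 2) ^ ((pp : ℕ) - 1) - ((256 * (c * b + a * a) ^ 3 : ℕ) : ℤ) ^ ((pp : ℕ) - 1)) :
    letI := T.instFieldF; letI := T.instNumberFieldF; letI := T.instAlgebraF; letI := T.instFieldK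
    letI := T.instNumberFieldK; letI := T.instAlgebraK; letI := T.instFieldFbar; letI := T.instAlgebraFbar
    letI := T.instAlgebraKFbar; letI := T.instIsElliptic
    haveI : Fact (pp : ℕ).Prime := ⟨pp.2⟩
    ∀ x₀ : (thetaIndex (pilotDataOfK T.D T.K)).Fibre (.inr pp),
      absRamificationIdx (pp : ℕ) (kOf (pilotDataOfK T.D T.K) pp.1 x₀) = (pp - 1) * (p' / Nat.gcd p' v) * l := by
  have hp2 : (pp : ℕ) ≠ 2 := by rcases hpq with ⟨h, -⟩ | ⟨h, -⟩ <;> omega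
  exact GenuineK.absRamificationIdx_kOf_eq_wildSplit_ratPoint T pp hpq hpl hv hpt
    (RadTriple.ord_jInv_eq_neg_two_mul habc pp.2 hp2 hv hdvd hndvd)
    (RadTriple.split_test_of_sq_dvd habc pp.2 hp2 hv hdvd hD)

end LocalType

/-! ## 2. Worked instances: the three triples of R-W «FREY-PINNED-28» set (A) at `p = 3` — exact types `10·l`, `2·l`, `30·l` -/

/-- **R-W set (A), datum `frey-160412424963707-…` at `3`: `e(K_{x₀}/ℚ₃) = 10·l`** for every genuine Θ-volume datum at
`(ratPoint (7³29⁵151²/3²⁷13⁴), l)`, `l ≠ 3` (`v₃(abc) = 27`, `3 ∣ 27`, `9 ∣ D`: SPLIT; `gcd(5, 27) = 1`). The 26 «pinned-only» rows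
`l = 29, 251, …, 397` of REFUTED-CERTS-PENDING-CLASS.tsv set (A) thus have the EXACT kernel type `e_v = 10`.
[cite: Serre1973, Ch. II §3.3] [cite: Mochizuki2012, IUTchIV Thm. 1.10 p. 22] [claim: Mochizuki2012, status: disputed] -/
theorem GenuineK.absRamificationIdx_kOf_frey160412424963707_three {l : ℕ}
    (T : Cor22.ThetaVolumeDatumAt (ratPoint (((7 ^ 3 * 29 ^ 5 * 151 ^ 2 : ℕ) : ℚ) / (3 ^ 27 * 13 ^ 4 : ℕ))) l) (hl : 3 ≠ l) :
    letI := T.instFieldF; letI := T.instNumberFieldF; letI := T.instAlgebraF; letI := T.instFieldK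
    letI := T.instNumberFieldK; letI := T.instAlgebraK; letI := T.instFieldFbar; letI := T.instAlgebraFbar
    letI := T.instAlgebraKFbar; letI := T.instIsElliptic
    haveI : Fact (Nat.Prime 3) := ⟨Nat.prime_three⟩
    ∀ x₀ : (thetaIndex (pilotDataOfK T.D T.K)).Fibre (.inr ⟨3, Nat.prime_three⟩),
      absRamificationIdx 3 (kOf (pilotDataOfK T.D T.K) 3 x₀) = 10 * l := by
  have h := GenuineK.absRamificationIdx_kOf_eq_wildSplit_of_triple (p' := 5) (v := 27) isABCTriple_frey160412424963707 T
    ⟨3, Nat.prime_three⟩ (Or.inl ⟨rfl, rfl⟩) hl (by norm_num) (by norm_num) (by norm_num) (by norm_num) (by norm_num)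
  intro x₀
  rw [h x₀]
  norm_num

/-- **R-W set (A), datum `frey-99794037551104-…` at `3`: `e(K_{x₀}/ℚ₃) = 2·l`** for every genuine Θ-volume datum at
`(ratPoint (2¹²13³223³/5¹⁵179⁴2141), l)`, `l ≠ 3` (`v₃(abc) = 15`, `3 ∣ 15`, `9 ∣ D`: SPLIT; `5 ∣ 15` so `r = 1`) — the row `l = 97` of
REFUTED-CERTS-PENDING-CLASS.tsv set (A) has the EXACT kernel type `e_v = 2`.
[cite: Serre1973, Ch. II §3.3] [cite: Mochizuki2012, IUTchIV Thm. 1.10 p. 22] [claim: Mochizuki2012, status: disputed] -/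
theorem GenuineK.absRamificationIdx_kOf_frey99794037551104_three {l : ℕ}
    (T : Cor22.ThetaVolumeDatumAt (ratPoint (((2 ^ 12 * 13 ^ 3 * 223 ^ 3 : ℕ) : ℚ) / (5 ^ 15 * 179 ^ 4 * 2141 : ℕ))) l)
    (hl : 3 ≠ l) :
    letI := T.instFieldF; letI := T.instNumberFieldF; letI := T.instAlgebraF; letI := T.instFieldK
    letI := T.instNumberFieldK; letI := T.instAlgebraK; letI := T.instFieldFbar; letI := T.instAlgebraFbar
    letI := T.instAlgebraKFbar; letI := T.instIsElliptic
    haveI : Fact (Nat.Prime 3) := ⟨Nat.prime_three⟩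
    ∀ x₀ : (thetaIndex (pilotDataOfK T.D T.K)).Fibre (.inr ⟨3, Nat.prime_three⟩),
      absRamificationIdx 3 (kOf (pilotDataOfK T.D T.K) 3 x₀) = 2 * l := by
  have h := GenuineK.absRamificationIdx_kOf_eq_wildSplit_of_triple (p' := 5) (v := 15) isABCTriple_frey99794037551104 T
    ⟨3, Nat.prime_three⟩ (Or.inl ⟨rfl, rfl⟩) hl (by norm_num) (by norm_num) (by norm_num) (by norm_num) (by norm_num)
  intro x₀
  rw [h x₀]
  norm_num

/-- **R-W set (A), datum `frey-8168354035667660710457-…` at `3`: `e(K_{x₀}/ℚ₃) = 30·l`** for every genuine Θ-volume datum at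
`(ratPoint (71⁸233³/3³⁸13⁴5233), l)`, `l ≠ 3` (`v₃(abc) = 38`, `3 ∤ 38`: W1, gen 2's theorem; `gcd(5, 38) = 1`) — the row `l = 71` of
REFUTED-CERTS-PENDING-CLASS.tsv set (A) has the EXACT kernel type `e_v = 30`.
[cite: Serre1972, §1.11–§1.12] [cite: Mochizuki2012, IUTchIV Thm. 1.10 p. 22] [claim: Mochizuki2012, status: disputed] -/
theorem GenuineK.absRamificationIdx_kOf_frey8168354035667660710457_three {l : ℕ}
    (T : Cor22.ThetaVolumeDatumAt (ratPoint (((71 ^ 8 * 233 ^ 3 : ℕ) : ℚ) / (3 ^ 38 * 13 ^ 4 * 5233 : ℕ))) l)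
    (hl : 3 ≠ l) :
    letI := T.instFieldF; letI := T.instNumberFieldF; letI := T.instAlgebraF; letI := T.instFieldK
    letI := T.instNumberFieldK; letI := T.instAlgebraK; letI := T.instFieldFbar; letI := T.instAlgebraFbar
    letI := T.instAlgebraKFbar; letI := T.instIsElliptic
    haveI : Fact (Nat.Prime 3) := ⟨Nat.prime_three⟩
    ∀ x₀ : (thetaIndex (pilotDataOfK T.D T.K)).Fibre (.inr ⟨3, Nat.prime_three⟩),
      absRamificationIdx 3 (kOf (pilotDataOfK T.D T.K) 3 x₀) = 30 * l := by
  have h := GenuineK.absRamificationIdx_kOf_eq_wild_of_triple (p' := 5) (v := 38) isABCTriple_frey8168354035667660710457 T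
    ⟨3, Nat.prime_three⟩ (Or.inl ⟨rfl, rfl⟩) hl (by norm_num) (by norm_num) (by norm_num) (by norm_num)
  intro x₀
  rw [h x₀]
  norm_num

end Summit.ABC.IUTFork.Conditional

end
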